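import Summits.CriticalPhenomena.PercolationContinuityZ3.Theorems.Transplant.KNCells2Kit
import Summits.CriticalPhenomena.PercolationContinuityZ3.Theorems.Transplant.KNCells2FacePrefix
import HarnessLib

/-!
# F8 (generic, LAG-1 ANCHORS) — the node theorem with the face-prefix inputs discharged by a level geometry
# (`samePWitnessAt_of_kit₂` + `facePrefix₂_P1/P2`; design HOME/prim-bschramm-p2-g2/F8-DESIGN.md §7)

builds on p205010 (kernel theorem, internal audit signed; external expert review pending) — nothing in this file uses p205010.
Lane `prim-bschramm`, seat `prim-bschramm-p2`; helper file (`--supports stmt-CriticalPhenomena-4575`).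

* **`samePWitnessAt_of_kit₂'`** — RunGeom + AnchGeom + SepGeom₂ + ExitGeom + StepsGeom + LevelGeom + degree/envelope bounds + `δc ≤ 1` +
  `4((1-δ₂)^K + ε') ≤ ε < 2⁻³²` + (32) at the root + per valid history at the history anchors: the target lemma at the faces (`hface`) and the
  corridor bound (`hreach`) ⟹ `SameP.SamePWitnessAt G root p`.  THE single target for the instances (X □ ℤ²: p3-g2; corridor: stmt).
[cite: KozmaNitzan2024, §4 Theorem 6 (pp. 25–31) — the ℤ^d model] [cite: GrimmettPercolation1999, §7.2]
-/

noncomputable section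

open MeasureTheory ProbabilityTheory
open scoped ENNReal Classical

namespace Summit.CriticalPhenomena.PercolationContinuityZ3.Theorems

namespace Transplant

namespace KNCells

open Literature.Probability.Percolation Literature.Probability.LatticeModels SimpleGraph GadgetSystem ProbeHistory HSiteScheme Contour

variable {V : Type*} [DecidableEq V] [Countable V]

namespace KSchA

variable {A : Type*} {G : SimpleGraph V} [G.LocallyFinite] {S : KSchA V A} {FD : FaceData V A} {LD : LevelData V A}

/-- **THE NODE OVER ANCHORED CELLS (lag-1 anchors) with the face-prefix inputs discharged by a level geometry.**
[cite: KozmaNitzan2024, §4 Theorem 6 (pp. 25–31)] -/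
theorem samePWitnessAt_of_kit₂' (hΓ : RunGeom G S.Γ) (hA : AnchGeom S.Γ) (hsep : SepGeom₂ G S.Γ) (hX : ExitGeom G S.Γ)
    (hSt : StepsGeom S.Γ FD) (hL : LevelGeom G S.Γ FD LD) {Δ B : ℕ} (hΔ : ∀ x, G.degree x ≤ Δ)
    (hB : ∀ (h : ProbeHistory V) (e : Site 2 × MDir) (a a' : A), (S.envRegion₂ G h e a a').card ≤ B)
    (hδc : S.δc ≤ 1) {ε ε' δ₂ : ℝ} (hε : ε < (1 / 2) ^ 32) (hε' : 0 ≤ ε') (hδ₂ : δ₂ ≤ 1)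
    (hKε : 4 * ((1 - δ₂) ^ S.Γ.K + ε') ≤ ε)
    (hQ0 : ∀ du : MDir, 1 - S.δc < (prodBernoulli (pinW (KNLevels.lattW G S.p) ↑(S.U₀ G) ↑(S.U₀ G))).real
      (⋃ t ∈ (↑(S.Γ.M S.Γ.a₀ ((0 : Site 2) + stepVec du)) : Set V),
        openConnIn (↑(S.Γ.Q S.Γ.a₀ 0 ∪ S.Γ.Ewv S.Γ.a₀ 0 du) : Set V) S.Γ.root t))
    (hface : ∀ h e, S.Valid₂ G h e → ∀ du ∈ S.onward G h (tgt e), ∀ j < S.Γ.K, ∀ o : Finset (Sym2 V),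
      1 - δ₂ < (prodBernoulli (S.Wt G h e (S.aOf₁ G h e) (S.aOf₂ G h e) du j o)).real
        (⋃ b ∈ FD.Face (S.aOf₂ G h e) (tgt e) du (j + 1), openConn S.Γ.root b) →
        S.cond G h e (S.aOf₁ G h e) (S.aOf₂ G h e) du j o)
    (hreach : ∀ h e, S.Valid₂ G h e → ∀ du ∈ S.onward G h (tgt e),
      1 - ε' < (prodBernoulli (S.Wfull G h e (S.aOf₁ G h e) (S.aOf₂ G h e) du)).real
        (S.Reach G FD h e (S.aOf₁ G h e) (S.aOf₂ G h e) du)) :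
    SameP.SamePWitnessAt G S.Γ.root S.p :=
  samePWitnessAt_of_kit₂ hΓ hA hsep hX hSt hΔ hB hδc hε hε' hδ₂ hKε hQ0 (fun _ _ hV => facePrefix₂_P1 hL hV)
    (fun _ _ hV => facePrefix₂_P2 hL hSt hV) hface hreach

end KSchA

end KNCells

end Transplant

end Summit.CriticalPhenomena.PercolationContinuityZ3.Theorems

end
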